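import Literature.MathematicalPhysics.QuantumFieldTheory.Balaban1983to89.B6L2BlockCalculus

/-!
# `Balaban1983to89.B6L2BlockGlobalNorm` — T. Bałaban, *Propagators and renormalization transformations for lattice gauge theories. I*,
# Commun. Math. Phys. **95** (1984) 17–40 [Balaban1984PropagatorsI], (1.89) p. 33 from (1.114) p. 36: a uniform `ℓ²`-BLOCK bound with
# exponential decay gives a GLOBAL `ℓ²` operator bound (the Schur test over the blocks) — file 23b of the unit's `ℓ²` programme (the tool by
# which the global members `‖∇∇GJ‖, ‖G∇*∇*J‖, ‖∇G∇*J‖ ≤ C‖J‖` of (1.89) for the two-scale `G` of [Balaban1984PropagatorsII] (2.90) are read off the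
# two-scale (1.114) members)

statement-level skeleton of published theorems with citation tags; proofs where landed; nothing here is a claim about the Yang–Mills mass gap

[4] p. 33 [PDF 17] (Proposition 1.1, (1.89), verbatim; ×2 render `…/1984-cmp95-propagators-rt-I/…-p017-x2.png` re-read 2026-08-22, v1.1): *"‖GJ‖, ‖∇GJ‖,
‖G∇*J‖, ‖∇G∇*J‖, ‖∇∇GJ‖, ‖G∇*∇*J‖ ≦ γ₀⁻¹‖J‖, (1.89) with a positive constant γ₀ independent of k, T_η, and depending on d only (if we put a = 1)"*
(this file's shape `‖·‖ ≤ C‖J‖` has our constant `C` in place of print's `γ₀⁻¹`); p. 36 (1.114): the same six norms, localized, with the factor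
`e^{−δ₀|y−y′|}`.  The passage local ⇒ global is the block Schur test: if `|⟨v, fu⟩| ≤ C·e^{−δρ(y,y′)}‖v‖‖u‖` for all `v`, `u`
supported over the blocks of `y`, `y′`, then `‖fJ‖ ≤ C·K(δ)·‖J‖` for every `J`, `K(δ) = sup_y Σ_{y′} e^{−δρ(y,y′)}` (`SumBound`).

WHAT THIS FILE DOES (abstract, finite index types fibred over a finite pseudo-metric space `Y`, as in file 23): **`normSq_apply_le_of_l2blk`** —
`Σ_i (fJ)_i² ≤ (C·K(δ))²·‖J‖²` — from file 23's fibre restrictions (`sum_restrict_eq`, `sum_norm_restrict_sq`, `norm_restrict_apply_le`) and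
Cauchy–Schwarz in the weights `e^{−δρ}`; and the norm form **`norm_apply_le_of_l2blk`**: `‖fJ‖ ≤ C·K(δ)·‖J‖`.  THEOREMS ONLY; standard axioms.
HONEST SCOPE: folklore bookkeeping (Schur test); constants ours; NOT summit progress.  Unit `lit-balaban-p22` (gen 16), 2026-08-22.  v1.1 (gen 17,
DOCSTRING-ONLY, declarations byte-identical): the (1.89) quotation made verbatim («≦ γ₀⁻¹‖J‖») — referee ref-4 g53 note S-B6-g53-1 (hygiene).
-/

noncomputable section

open scoped InnerProductSpace BigOperators
open Finset

namespace Literature.MathematicalPhysics.QuantumFieldTheory.Balaban1983to89.B6L2BlockGlobalNorm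

open B4Sect5Torus (IsPseudoDist SumBound)
open B6L2BlockCalculus (restrict_apply_of_ne sum_restrict_eq sum_norm_restrict_sq norm_restrict_apply_le)

variable {Y : Type*} {ρ : Y → Y → ℝ} {KY : ℝ → ℝ} {ι κ : Type} [Fintype ι] [Fintype κ]

/-- Cauchy–Schwarz with nonnegative weights: `(Σ w·b)² ≤ (Σ w)·(Σ w·b²)` (private helper). [folklore] -/
private theorem sq_sum_mul_le_sum_mul_sum (s : Finset Y) (w b : Y → ℝ) (hw : ∀ y ∈ s, 0 ≤ w y) :
    (∑ y ∈ s, w y * b y) ^ 2 ≤ (∑ y ∈ s, w y) * ∑ y ∈ s, w y * b y ^ 2 := by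
  have h := Finset.sum_mul_sq_le_sq_mul_sq s (fun y => Real.sqrt (w y)) (fun y => Real.sqrt (w y) * b y)
  have h1 : ∀ y ∈ s, Real.sqrt (w y) * (Real.sqrt (w y) * b y) = w y * b y := fun y hy => by
    rw [← mul_assoc, Real.mul_self_sqrt (hw y hy)]
  have h2 : ∀ y ∈ s, Real.sqrt (w y) ^ 2 = w y := fun y hy => Real.sq_sqrt (hw y hy)
  have h3 : ∀ y ∈ s, (Real.sqrt (w y) * b y) ^ 2 = w y * b y ^ 2 := fun y hy => by rw [mul_pow, Real.sq_sqrt (hw y hy)]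
  rwa [Finset.sum_congr rfl h1, Finset.sum_congr rfl h2, Finset.sum_congr rfl h3] at h

/-- **A UNIFORM `ℓ²`-BLOCK BOUND WITH DECAY GIVES A GLOBAL `ℓ²` BOUND** (Schur test over the blocks): if `|⟨v, fu⟩| ≤ C·e^{−δρ(y,y′)}‖v‖‖u‖` for all
`v` over the fibre of `y` and `u` over the fibre of `y′`, then `Σ_i (fJ)_i² ≤ (C·K(δ))²‖J‖²` for every `J`.
[cite: Balaban1984PropagatorsI, Prop. 1.1 (1.89) p.33, (1.114) p.36 (local ⇒ global; bookkeeping ours)] -/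
theorem normSq_apply_le_of_l2blk [Fintype Y] [DecidableEq Y] (hρ : IsPseudoDist ρ) (hK : SumBound ρ KY)
    (f : EuclideanSpace ℝ κ →ₗ[ℝ] EuclideanSpace ℝ ι) (pι : ι → Y) (pκ : κ → Y) {C δ : ℝ} (hC : 0 ≤ C) (hδ : 0 < δ) (hKY : 0 ≤ KY δ)
    (hf : ∀ (y y' : Y) (v : EuclideanSpace ℝ ι) (u : EuclideanSpace ℝ κ), (∀ i, pι i ≠ y → v i = 0) → (∀ k, pκ k ≠ y' → u k = 0) →
      |⟪v, f u⟫_ℝ| ≤ C * Real.exp (-(δ * ρ y y')) * (‖v‖ * ‖u‖))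
    (J : EuclideanSpace ℝ κ) :
    ∑ i, (f J i) ^ 2 ≤ (C * KY δ) ^ 2 * ‖J‖ ^ 2 := by
  classical
  set Jr : Y → EuclideanSpace ℝ κ := fun y' => WithLp.toLp 2 (fun k => if pκ k = y' then J k else 0) with hJr
  set R : Y → EuclideanSpace ℝ ι := fun y => WithLp.toLp 2 (fun i => if pι i = y then f J i else 0) with hR
  have hJsum : ∑ y', Jr y' = J := sum_restrict_eq pκ J
  have hsuppJr : ∀ y' k, pκ k ≠ y' → Jr y' k = 0 := fun y' k hk => restrict_apply_of_ne pκ J y' k hk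
  set e : Y → Y → ℝ := fun y y' => Real.exp (-(δ * ρ y y')) with he
  have he0 : ∀ y y', 0 ≤ e y y' := fun _ _ => (Real.exp_pos _).le
  set b : Y → ℝ := fun y' => ‖Jr y'‖ with hb
  -- (a) `‖(fJ)↾y‖ ≤ C Σ_{y′} e(y,y′) ‖J↾y′‖`
  have ha : ∀ y, ‖R y‖ ≤ C * ∑ y', e y y' * b y' := by
    intro y
    have hdec : R y = ∑ y', (WithLp.toLp 2 (fun i => if pι i = y then f (Jr y') i else 0) : EuclideanSpace ℝ ι) := by
      apply PiLp.ext
      intro i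
      rw [WithLp.ofLp_sum, Finset.sum_apply]
      show (if pι i = y then f J i else 0) = ∑ y', (WithLp.toLp 2 (fun i => if pι i = y then f (Jr y') i else 0) : EuclideanSpace ℝ ι) i
      have hfi : f J i = ∑ y', f (Jr y') i := by
        conv_lhs => rw [← hJsum]
        rw [map_sum, WithLp.ofLp_sum, Finset.sum_apply]
      by_cases hi : pι i = y
      · rw [if_pos hi, hfi]
        refine Finset.sum_congr rfl fun y' _ => ?_
        show f (Jr y') i = (if pι i = y then f (Jr y') i else 0)
        rw [if_pos hi]
      · rw [if_neg hi]
        symm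
        refine Finset.sum_eq_zero fun y' _ => ?_
        show (if pι i = y then f (Jr y') i else 0) = 0
        rw [if_neg hi]
    rw [hdec, Finset.mul_sum]
    refine (norm_sum_le _ _).trans (Finset.sum_le_sum fun y' _ => ?_)
    have h := norm_restrict_apply_le f pι pκ hC hf y y' (Jr y') (hsuppJr y')
    simpa only [he, hb, mul_assoc] using h
  -- (b) Schur over the blocks
  have hrow : ∀ y, ∑ y', e y y' ≤ KY δ := fun y => hK δ hδ y
  have hcol : ∀ y', ∑ y, e y y' ≤ KY δ := by
    intro y'
    have h := hK δ hδ y'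
    refine le_of_eq_of_le (Finset.sum_congr rfl fun y _ => ?_) h
    show Real.exp (-(δ * ρ y y')) = Real.exp (-(δ * ρ y' y))
    rw [hρ.symm y y']
  have hstep : ∀ y, ‖R y‖ ^ 2 ≤ C ^ 2 * (KY δ * ∑ y', e y y' * b y' ^ 2) := by
    intro y
    have h1 : ‖R y‖ ^ 2 ≤ (C * ∑ y', e y y' * b y') ^ 2 := pow_le_pow_left₀ (norm_nonneg _) (ha y) 2
    have h2 : (∑ y', e y y' * b y') ^ 2 ≤ (∑ y', e y y') * ∑ y', e y y' * b y' ^ 2 :=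
      sq_sum_mul_le_sum_mul_sum univ (e y) b (fun y' _ => he0 y y')
    have h3 : (∑ y', e y y') * ∑ y', e y y' * b y' ^ 2 ≤ KY δ * ∑ y', e y y' * b y' ^ 2 :=
      mul_le_mul_of_nonneg_right (hrow y) (Finset.sum_nonneg fun y' _ => mul_nonneg (he0 y y') (sq_nonneg _))
    rw [mul_pow] at h1
    nlinarith [sq_nonneg C]
  have hsum : ∑ y, ‖R y‖ ^ 2 ≤ C ^ 2 * (KY δ * (KY δ * ∑ y', b y' ^ 2)) := by
    refine (Finset.sum_le_sum fun y _ => hstep y).trans ?_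
    rw [← Finset.mul_sum, ← Finset.mul_sum]
    refine mul_le_mul_of_nonneg_left (mul_le_mul_of_nonneg_left ?_ hKY) (sq_nonneg C)
    rw [Finset.sum_comm, Finset.mul_sum]
    refine Finset.sum_le_sum fun y' _ => ?_
    rw [← Finset.sum_mul]
    exact mul_le_mul_of_nonneg_right (hcol y') (sq_nonneg _)
  -- (c) the two Parseval identities
  have hL : ∑ i, (f J i) ^ 2 = ∑ y, ‖R y‖ ^ 2 := by
    rw [hR, sum_norm_restrict_sq pι (f J), EuclideanSpace.real_norm_sq_eq]
  have hJ : ∑ y', b y' ^ 2 = ‖J‖ ^ 2 := by rw [hb]; exact sum_norm_restrict_sq pκ J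
  rw [hL]
  refine hsum.trans (le_of_eq ?_)
  rw [hJ]; ring

/-- **the norm form**: `‖fJ‖ ≤ C·K(δ)·‖J‖`. [cite: Balaban1984PropagatorsI, Prop. 1.1 (1.89) p.33, (1.114) p.36 (local ⇒ global; bookkeeping ours)] -/
theorem norm_apply_le_of_l2blk [Fintype Y] [DecidableEq Y] (hρ : IsPseudoDist ρ) (hK : SumBound ρ KY)
    (f : EuclideanSpace ℝ κ →ₗ[ℝ] EuclideanSpace ℝ ι) (pι : ι → Y) (pκ : κ → Y) {C δ : ℝ} (hC : 0 ≤ C) (hδ : 0 < δ) (hKY : 0 ≤ KY δ)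
    (hf : ∀ (y y' : Y) (v : EuclideanSpace ℝ ι) (u : EuclideanSpace ℝ κ), (∀ i, pι i ≠ y → v i = 0) → (∀ k, pκ k ≠ y' → u k = 0) →
      |⟪v, f u⟫_ℝ| ≤ C * Real.exp (-(δ * ρ y y')) * (‖v‖ * ‖u‖))
    (J : EuclideanSpace ℝ κ) :
    ‖f J‖ ≤ C * KY δ * ‖J‖ := by
  have h := normSq_apply_le_of_l2blk hρ hK f pι pκ hC hδ hKY hf J
  rw [← EuclideanSpace.real_norm_sq_eq, ← mul_pow] at h
  exact (pow_le_pow_iff_left₀ (norm_nonneg _) (by positivity) two_ne_zero).1 h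

end Literature.MathematicalPhysics.QuantumFieldTheory.Balaban1983to89.B6L2BlockGlobalNorm

end
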